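import Summits.AnomalousDissipation.AnomalousDissipation.Theorems.SolenoidalFractalHomogenisationLagrangianStepD1Split
import Summits.AnomalousDissipation.AnomalousDissipation.Theorems.SolenoidalFractalHomogenisationLagrangianStepD1Family

/-!
# K1L_D (stmt-AnomalousDissipation-27980): the D1 SPLIT GLUE, WINDOW-HONEST RE-CUT (ruling D27-1, tenure planner ad-ideate-p1 g27; TAKE G27-1)
(helper, `--supports 27980 --as helper`; prover ad-sawtooth-k1loc-p1 g14.)

Ruling D27-1 re-cuts the open clause-(ii) stub `stub_D1_V0` of registry v16–v21 to `stub_D1_V0R` = «clause (i) (the registered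
`stub_D1_residue` text, an unconditional theorem since v21/p701440) ⇒ clause (ii) on the SECTOR-HONEST sub-windows», i.e. the (V) clause
is asked only on sub-windows `(lo, hi, ΛV, β)` of the block window that satisfy the ONE extra guard `β * ΛV ≤ lo / 20`: exactly there every
clause tensor `S ∈ NearIso(lo/λ, hi·λ) ∩ OddSmall β`, `λ ∈ [1, ΛV]`, lies in `NearIso(10/11, 11/10) ∩ OddSectorial ≤ 1/20`, the domain on
which the residue (hence the coercivity input `c₀(W)` of finding F-w1g7-1) is known.

This file is the tree glue the re-cut needs — copies of the landed split glue `…D1Split` (p686447) and of the landed consumer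
`WCrossing.cellLawV0_IS_statement_of_D1` / `WCrossing.cellLawV0_IS_of_W_D1` (`…WCrossingWindow`, p683011) with the guard threaded through:
* `D1ExactFamilyR` — `D1ExactFamily` with `β * ΛV ≤ lo / 20 →` inserted after `10/11 * ΛV ≤ lo →` in clause (ii);
* `D1ExactFamilyR_of_split`, `D1ExactFamilyRB_of_split` — the split with the guarded (V) hypothesis;
* `cellLawV0_IS_statement_of_D1R`, `cellLawV0_IS_of_W_D1R` — the consumer: its instance `β := τlo·(shi·Λc)`, `lo := slo/Λc` satisfies the
  guard by the `ClosedFormWindowB` fits `τlo·ΛV·(shi·Λc)/(slo/Λc) ≤ τ₀ ≤ 1/20` (`consumer_guard`), so the conclusion — the registered text of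
  `stub_cellLawV0_IS` — is UNCHANGED;
* `D1ExactFamilyR_of_D1ExactFamily`, `window_in_sector` — sanity: the old obligation implies the new one; the guarded window lies in clause (i)'s domain.
Registry use (v22): `theorem D1_V0_window := stub_D1_V0R stub_D1_residue`, `stub_D1_exactFamilyR := D1ExactFamilyRB_of_split νB₁_pos stub_D1_residue
D1_V0_window`, `stub_cellLawV0_IS := cellLawV0_IS_of_W_D1R stub_W_evenSlackB stub_D1_exactFamilyR`.  NOT a proof of K1L_D or AD; rung F-D1.A0.
-/

set_option linter.dupNamespace false

namespace Summit.AnomalousDissipation.AnomalousDissipation.Theorems.SolenoidalFractalHomogenisation.LagrangianStep.WCrossing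

open Summit.AnomalousDissipation.AnomalousDissipation.Theorems
open Summit.AnomalousDissipation.AnomalousDissipation.Theorems.SolenoidalFractalHomogenisation.LagrangianStep
open Literature.Analysis Literature.Analysis.FluidPDE Literature.Analysis.FunctionSpaces
open Set

noncomputable section

/-- **OBLIGATION D1, window-honest form (D27-1).**  `D1ExactFamily Φ₀ ρ M hM` with clause (ii) asked only on the sub-windows that satisfy
the sector guard `β * ΛV ≤ lo / 20` (the binder inserted after `10/11 * ΛV ≤ lo →`); clause (i) unchanged. -/
def D1ExactFamilyR (Φ₀ : T4 → T4) (ρ M : ℝ) (hM : 0 < M) : Prop :=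
  ∃ Ψ : ℝ → T4 → T4,
    (∀ ν : ℝ, ∀ S : T4, Torus.NearIso S (10 / 11) (11 / 10) → ∀ τ ∈ Set.Icc (0:ℝ) (1 / 20), OddSectorial S τ →
        RelSmall (Ψ ν S - Φ₀ S) (Φ₀ S) ρ) ∧
    (∃ c > (0:ℝ), ∀ lo hi ΛV β : ℝ, 0 < lo → lo ≤ hi → 1 < ΛV → 0 ≤ β → hi * ΛV ≤ 11 / 10 → 10 / 11 * ΛV ≤ lo → β * ΛV ≤ lo / 20 →
        ∃ σ > (0:ℝ), ∃ C : ℝ, 0 ≤ C ∧ ∃ ν₀ > (0:ℝ), ∃ K > (0:ℝ), SlowVectorClauseNoExF cubatureWord M hM c Ψ lo hi ΛV β σ C ν₀ K)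

/-- The unguarded obligation implies the guarded one (every line of the (V) lane's work against `D1ExactFamily` transfers). [folklore] -/
theorem D1ExactFamilyR_of_D1ExactFamily {Φ₀ : T4 → T4} {ρ M : ℝ} {hM : 0 < M} (h : D1ExactFamily Φ₀ ρ M hM) :
    D1ExactFamilyR Φ₀ ρ M hM := by
  obtain ⟨Ψ, hres, c, hc, hV⟩ := h
  exact ⟨Ψ, hres, c, hc, fun lo hi ΛV β hlo hlh hΛV hβ h1 h2 _ => hV lo hi ΛV β hlo hlh hΛV hβ h1 h2⟩

/-- **Why the guard is the honest one.**  Under `β * ΛV ≤ lo / 20` every tensor of the clause window — `S ∈ NearIso(lo/λ, hi·λ) ∩ OddSmall β`,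
`λ ∈ [1, ΛV]`, on a sub-window `hi·ΛV ≤ 11/10`, `10/11·ΛV ≤ lo` — lies in clause (i)'s domain `NearIso(10/11, 11/10) ∩ OddSectorial τ`, `τ ≤ 1/20`
(`NearIso.mono`, `oddSectorial_of_oddSmall` with `τ := β/(lo/λ) ≤ β·ΛV/lo ≤ 1/20`). [folklore] -/
theorem window_in_sector {S : T4} {lo hi ΛV β lam : ℝ} (hlo : 0 < lo) (hlh : lo ≤ hi) (h1 : hi * ΛV ≤ 11 / 10)
    (h2 : 10 / 11 * ΛV ≤ lo) (hβ0 : 0 ≤ β) (hβ : β * ΛV ≤ lo / 20) (hlam : lam ∈ Set.Icc 1 ΛV) (hN : Torus.NearIso S (lo / lam) (hi * lam))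
    (hO : Torus.OddSmall S β) :
    Torus.NearIso S (10 / 11) (11 / 10) ∧ ∃ τ ∈ Set.Icc (0:ℝ) (1 / 20), OddSectorial S τ := by
  have hlam0 : 0 < lam := lt_of_lt_of_le one_pos hlam.1
  have hlolam : 0 < lo / lam := div_pos hlo hlam0
  refine ⟨hN.mono ?_ ?_, β / (lo / lam), ⟨div_nonneg hβ0 hlolam.le, ?_⟩, oddSectorial_of_oddSmall hO hN hlolam⟩
  · rw [le_div_iff₀ hlam0]; nlinarith [hlam.1, hlam.2]
  · have hhi : 0 ≤ hi := hlo.le.trans hlh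
    nlinarith [mul_le_mul_of_nonneg_left hlam.2 hhi]
  · rw [div_le_iff₀ hlolam]
    have : 1 / 20 * (lo / lam) = lo / 20 / lam := by ring
    rw [this, le_div_iff₀ hlam0]
    nlinarith [mul_le_mul_of_nonneg_left hlam.2 hβ0]

/-- **`D1ExactFamilyR` from the split** (copy of `D1ExactFamily_of_split`, p686447, with the guarded (V) hypothesis): a residue bound for the exact
family `Ψ₁` on `ν ∈ (0, ν₁]`, transverse nonnegativity of the design map on the block window, and the GUARDED (V) clause for `Ψ₁` give
`D1ExactFamilyR Φ₀ ρ M hM`, witnessed by `pieceFamily Ψ₁ Φ₀ ν₁`. -/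
theorem D1ExactFamilyR_of_split {Φ₀ : T4 → T4} {Ψ₁ : ℝ → T4 → T4} {ρ M ν₁ : ℝ} (hM : 0 < M) (hρ : 0 ≤ ρ) (hν₁ : 0 < ν₁)
    (h0 : ∀ S : T4, Torus.NearIso S (10 / 11) (11 / 10) → ∀ τ ∈ Set.Icc (0:ℝ) (1 / 20), OddSectorial S τ → TransNonneg (Φ₀ S))
    (hres : ∀ ν ∈ Set.Ioc 0 ν₁, ∀ S : T4, Torus.NearIso S (10 / 11) (11 / 10) → ∀ τ ∈ Set.Icc (0:ℝ) (1 / 20), OddSectorial S τ →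
      RelSmall (Ψ₁ ν S - Φ₀ S) (Φ₀ S) ρ)
    (hV0 : ∃ c > (0:ℝ), ∀ lo hi ΛV β : ℝ, 0 < lo → lo ≤ hi → 1 < ΛV → 0 ≤ β → hi * ΛV ≤ 11 / 10 → 10 / 11 * ΛV ≤ lo → β * ΛV ≤ lo / 20 →
      ∃ σ > (0:ℝ), ∃ C : ℝ, 0 ≤ C ∧ ∃ ν₀ > (0:ℝ), ∃ K > (0:ℝ), SlowVectorClauseNoExF cubatureWord M hM c Ψ₁ lo hi ΛV β σ C ν₀ K) :
    D1ExactFamilyR Φ₀ ρ M hM := by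
  refine ⟨pieceFamily Ψ₁ Φ₀ ν₁, ?_, ?_⟩
  · intro ν S hS τ hτ hodd
    by_cases hν : 0 < ν ∧ ν ≤ ν₁
    · rw [pieceFamily_of_mem hν]
      exact hres ν ⟨hν.1, hν.2⟩ S hS τ hτ hodd
    · rw [pieceFamily_of_not_mem hν, sub_self]
      exact RelSmall.zero (h0 S hS τ hτ hodd) hρ
  · obtain ⟨c, hc, hV⟩ := hV0
    refine ⟨c, hc, fun lo hi ΛV β hlo hlh hΛV hβ h1 h2 h3 => ?_⟩
    obtain ⟨σ, hσ, C, hC, ν₀, hν₀, K, hK, hcl⟩ := hV lo hi ΛV β hlo hlh hΛV hβ h1 h2 h3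
    refine ⟨σ, hσ, C, hC, min ν₀ ν₁, lt_min hν₀ hν₁, K, hK, ?_⟩
    refine SlowVectorClauseNoExF.congr_Ioo (fun ν hν => ?_) (SlowVectorClauseNoExF.mono_ν₀ (min_le_left ν₀ ν₁) hcl)
    exact (pieceFamily_of_mem ⟨hν.1, hν.2.le.trans (min_le_right _ _)⟩).symm

/-- **The branch-B D1 obligation, window-honest form, from the split** (copy of `D1ExactFamilyB_of_split` with the guarded (V) hypothesis): for every
normalisation `a > 0`, the residue bound for `Ψ₁ a` on `ν ∈ (0, ν₁]` (= the registered `stub_D1_residue` text at `Ψ₁ := ΨB₁`, `ν₁ := νB₁`) and the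
GUARDED (V) clause for `Ψ₁ a` (= the conclusion of `stub_D1_V0R`) give `D1ExactFamilyR (ΦB a) ρB MB MB_pos` — the shape registry v22 consumes
(`stub_D1_exactFamilyR := D1ExactFamilyRB_of_split νB₁_pos stub_D1_residue (stub_D1_V0R stub_D1_residue)`). -/
theorem D1ExactFamilyRB_of_split {Ψ₁ : ℝ → ℝ → T4 → T4} {ν₁ : ℝ} (hν₁ : 0 < ν₁)
    (hres : ∀ a > (0:ℝ), ∀ ν ∈ Set.Ioc 0 ν₁, ∀ S : T4, Torus.NearIso S (10 / 11) (11 / 10) →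
      ∀ τ ∈ Set.Icc (0:ℝ) (1 / 20), OddSectorial S τ → RelSmall (Ψ₁ a ν S - ΦB a S) (ΦB a S) ρB)
    (hV0 : ∀ a > (0:ℝ), ∃ c > (0:ℝ), ∀ lo hi ΛV β : ℝ, 0 < lo → lo ≤ hi → 1 < ΛV → 0 ≤ β → hi * ΛV ≤ 11 / 10 → 10 / 11 * ΛV ≤ lo →
      β * ΛV ≤ lo / 20 →
      ∃ σ > (0:ℝ), ∃ C : ℝ, 0 ≤ C ∧ ∃ ν₀ > (0:ℝ), ∃ K > (0:ℝ), SlowVectorClauseNoExF cubatureWord MB MB_pos c (Ψ₁ a) lo hi ΛV β σ C ν₀ K) :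
    ∀ a > (0:ℝ), D1ExactFamilyR (ΦB a) ρB MB MB_pos := by
  intro a ha
  exact D1ExactFamilyR_of_split MB_pos ρB_nonneg hν₁ (fun S hS τ hτ hodd => transNonneg_ΦB ha.le hS hτ hodd) (hres a ha) (hV0 a ha)

/-- **The consumer's instance satisfies the guard**: with `β := τlo·(shi·Λc)`, `lo := slo/Λc` the `ClosedFormWindowB` fits
`τlo·ΛV·(shi·Λc)/(slo/Λc) ≤ τ₀ ≤ 1/20` give `β·ΛV ≤ lo/20`. [folklore] -/
theorem consumer_guard {slo shi Λc ΛV τ₀ τlo : ℝ} (hslo : 0 < slo) (hΛc : 1 ≤ Λc)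
    (hτ₀ : τlo * ΛV * (shi * Λc) / (slo / Λc) ≤ τ₀) (hτ₀' : τ₀ ≤ 1 / 20) :
    τlo * (shi * Λc) * ΛV ≤ slo / Λc / 20 := by
  have hΛc0 : 0 < Λc := by linarith
  have hl : 0 < slo / Λc := div_pos hslo hΛc0
  have h := (div_le_iff₀ hl).1 (hτ₀.trans hτ₀')
  have : τlo * (shi * Λc) * ΛV = τlo * ΛV * (shi * Λc) := by ring
  rw [this]
  linarith

/-- **The conclusion of `stub_cellLawV0_IS` from the two obligations, window-honest form** (copy of `cellLawV0_IS_statement_of_D1` with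
`hD : D1ExactFamilyR …`; the one new goal — the guard at the consumer's instance — is `consumer_guard`). [folklore] -/
theorem cellLawV0_IS_statement_of_D1R {Φ₀ : T4 → T4} {ρ M : ℝ} (hM : 0 < M) (hρ0 : 0 ≤ ρ)
    (hW : ClosedFormWindowB Φ₀ ρ) (hD : D1ExactFamilyR Φ₀ ρ M hM) :
    ∃ M : ℝ, ∃ hM : 0 < M, ∃ c > (0:ℝ), ∃ Φ : ℝ → Torus.Visc4 (Fin 3) → Torus.Visc4 (Fin 3), ∃ μ : ℝ → ℝ, ∃ Sstar : Torus.Visc4 (Fin 3),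
      ∃ slo shi lam₀ Λ Λc Λ' τlo τhi τc : ℝ, ∃ lo > (0:ℝ), ∃ hi : ℝ, lo ≤ 1 ∧ 1 ≤ hi ∧ ∃ ΛV > (1:ℝ), ∃ β ≥ (0:ℝ),
        SectorialIntervalWindowFamily Φ μ Sstar slo shi lam₀ Λ Λc Λ' τlo τhi τc β lo hi ΛV ∧
        ∃ σ > (0:ℝ), ∃ C : ℝ, 0 ≤ C ∧ ∃ ν₀ > (0:ℝ), ∃ K > (0:ℝ), SlowVectorClauseNoExF cubatureWord M hM c Φ lo hi ΛV β σ C ν₀ K := by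
  obtain ⟨Sstar, slo, shi, lam₀, Λ, Λc, ΛV, τ₀, κ, ε, δ, hstarI, hslo, hslo1, hshi1, hlam₀, hiso, hκ, hε, hδ, hfit, hgain, hΛc, hΛV,
    hfitV, hwinhi, hwinlo, hVhi, hVlo, hτ₀, hτ₀', hO, hE⟩ := hW
  obtain ⟨Ψ, hres, c, hc, hVc⟩ := hD
  have hΛc1 : 1 ≤ Λc := hlam₀.trans hΛc
  have hΛc0 : 0 < Λc := by linarith
  set τlo : ℝ := (ε + 2 * ρ) / (1 - ρ - κ) with hτlo_def
  have hτlo0 : 0 ≤ τlo := div_nonneg (by linarith) (by linarith)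
  -- the residue on the interval window
  have hR : ∀ ν, ResidueOnInterval (Ψ ν) Φ₀ Sstar lam₀ Λ τ₀ ρ := by
    intro ν lam hlam S τ hτ hSi hSo
    have hlam1 : 1 ≤ lam := hlam₀.trans hlam.1
    have hlam0 : 0 < lam := by linarith
    have hN : Torus.NearIso S (10 / 11) (11 / 10) := by
      refine (InInterval.nearIso hlam1 hstarI hSi).mono ?_ ?_
      · rw [le_div_iff₀ hlam0]; nlinarith [hlam.2]
      · nlinarith [hlam.2, hslo.trans_le (hslo1.trans hshi1)]
    exact hres ν S hN τ ⟨hτ.1, hτ.2.trans hτ₀'⟩ hSo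
  -- the (V) clause on the window (slo/Λc, shi·Λc, ΛV, τlo·shi·Λc); the guard holds by `consumer_guard`
  have hV := hVc (slo / Λc) (shi * Λc) ΛV (τlo * (shi * Λc)) (div_pos hslo hΛc0)
    ((div_le_self hslo.le hΛc1).trans (hslo1.trans (hshi1.trans (le_mul_of_one_le_right (by linarith) hΛc1))))
    hΛV (mul_nonneg hτlo0 (by positivity)) hVhi hVlo (consumer_guard hslo hΛc1 hτ₀ hτ₀')
  exact cellLawV0_IS_statement_of_WCrossing hM hc hstarI hslo hslo1 hshi1 hlam₀ hiso hO hE hR hκ hε hρ0 hδ hfit hgain le_rfl hΛc hΛV hfitV hτ₀ hV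

/-- **Registry-v22 glue: `stub_cellLawV0_IS` from the two by-name obligations, window-honest form** (copy of `cellLawV0_IS_of_W_D1`): the
even-slack window at the branch-B point for some normalisation (`stub_W_evenSlackB`, landed `WEvenCert.stub_W_evenSlackB`) and the window-honest
exact family for every normalisation (`∀ a > 0, D1ExactFamilyR (ΦB a) ρB MB MB_pos`) give the registered stub's statement VERBATIM. -/
theorem cellLawV0_IS_of_W_D1R (hW : ∃ a > (0:ℝ), EvenSlackWindowB a ρB)
    (hD : ∀ a > (0:ℝ), D1ExactFamilyR (ΦB a) ρB MB MB_pos) :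
    ScalarLawBlock Summit.AnomalousDissipation.AnomalousDissipation.Theorems.cubatureWord Summit.AnomalousDissipation.AnomalousDissipation.Theorems.c0 →
    ∃ M : ℝ, ∃ hM : 0 < M, ∃ c > (0:ℝ), ∃ Φ : ℝ → Torus.Visc4 (Fin 3) → Torus.Visc4 (Fin 3), ∃ μ : ℝ → ℝ,
      ∃ Sstar : Torus.Visc4 (Fin 3), ∃ slo shi lam₀ Λ Λc Λ' τlo τhi τc : ℝ,
      ∃ lo > (0:ℝ), ∃ hi : ℝ, lo ≤ 1 ∧ 1 ≤ hi ∧ ∃ ΛV > (1:ℝ), ∃ β ≥ (0:ℝ),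
      SectorialIntervalWindowFamily Φ μ Sstar slo shi lam₀ Λ Λc Λ' τlo τhi τc β lo hi ΛV ∧
      ∃ σ > (0:ℝ), ∃ C : ℝ, 0 ≤ C ∧ ∃ ν₀ > (0:ℝ), ∃ K > (0:ℝ), SlowVectorClauseNoExF Summit.AnomalousDissipation.AnomalousDissipation.Theorems.cubatureWord M hM c Φ lo hi ΛV β σ C ν₀ K := by
  intro _
  obtain ⟨a, ha, h⟩ := hW
  exact cellLawV0_IS_statement_of_D1R MB_pos ρB_nonneg (closedFormWindowB_of_evenSlack h) (hD a ha)

/-- **The registry's one-line use (sanity, the v22 shape):** the residue theorem (registered `stub_D1_residue` text) and the re-cut stub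
`stub_D1_V0R` («(i) ⇒ guarded (ii)») give the window-honest branch-B obligation for every normalisation. [folklore] -/
theorem D1ExactFamilyRB_of_residue_of_V0R
    (hres : ∀ a > (0:ℝ), ∀ ν ∈ Set.Ioc 0 νB₁, ∀ S, Torus.NearIso S (10/11) (11/10) →
      ∀ τ ∈ Set.Icc (0:ℝ) (1/20), OddSectorial S τ → RelSmall (ΨB₁ a ν S - ΦB a S) (ΦB a S) ρB)
    (hV0R : (∀ a > (0:ℝ), ∀ ν ∈ Set.Ioc 0 νB₁, ∀ S, Torus.NearIso S (10/11) (11/10) →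
      ∀ τ ∈ Set.Icc (0:ℝ) (1/20), OddSectorial S τ → RelSmall (ΨB₁ a ν S - ΦB a S) (ΦB a S) ρB) →
      ∀ a > (0:ℝ), ∃ c > (0:ℝ), ∀ lo hi ΛV β : ℝ, 0 < lo → lo ≤ hi → 1 < ΛV → 0 ≤ β → hi * ΛV ≤ 11/10 → 10/11 * ΛV ≤ lo → β * ΛV ≤ lo / 20 →
        ∃ σ > (0:ℝ), ∃ C : ℝ, 0 ≤ C ∧ ∃ ν₀ > (0:ℝ), ∃ K > (0:ℝ),
          SlowVectorClauseNoExF cubatureWord MB MB_pos c (ΨB₁ a) lo hi ΛV β σ C ν₀ K) :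
    ∀ a > (0:ℝ), D1ExactFamilyR (ΦB a) ρB MB MB_pos :=
  D1ExactFamilyRB_of_split νB₁_pos hres (hV0R hres)

end

end Summit.AnomalousDissipation.AnomalousDissipation.Theorems.SolenoidalFractalHomogenisation.LagrangianStep.WCrossing
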